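import Summits.QuantumFields.YangMills.Theorems.ForcedResponseSkewnessRunningCouplingCeilingScaleFreeOfMomentBounds
import Summits.QuantumFields.YangMills.Theorems.BalabanLadderUVSeamRecCeilingsTransfer
import HarnessLib

/-!
# Crux `RunningCouplingCeiling` (stmt-QuantumFields-24275), reshaped line «pointwise-log-ceiling-r» (local split):
# the local scale-free clause in a unit `a` from `MomentBounds6` in a REFERENCE unit `u` not finer than `a`

Support file (`--supports stmt-QuantumFields-24275 --as helper`) by the width prover `ym-line-frs-p3` (g2) of route
`ForcedResponseSkewness` (lead `ym-line-frs-p1`).  The reshaped skeleton's stub `stub_scaleFreeLocal : ScaleFreeLocalSigR`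
asks, for EVERY unit map `a → 0⁺` and every radius `ℓ`, the local scale-free clause
`n₀ ≤ d → a(β)·d ≤ ℓ → d⁸|torusCov β L x y| ≤ C₁`.  The tree discharges it from `MomentBounds6 G r a` IN THE SAME UNIT
(`localScaleFree_of_momentBounds6`, p593932); the spine `BalabanLadder` supplies `MomentBounds6` in its RECORD unit `u`, and the
tree's `momentBounds6_of_eventually_le` transports `MomentBounds6` from `u` to any unit `a` with `u ≤ c·a` eventually (i.e. `a`
NOT FINER than `u`).  Composing:

* `localScaleFree_of_momentBounds6_of_eventually_le` — **`MomentBounds6 G r u` and `∀ᶠ β, u β ≤ c·a β` (`c > 0`) imply the local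
  scale-free clause in the unit `a`** (every `ℓ > 0`).

So for unit maps comparable from below to the record unit the stub is femto/UV-class (the spine's E0′ ceilings); for unit
maps FINER than the record unit the cap `a(β)·d ≤ ℓ` reaches unbounded separations in record units and the clause is
hyperscaling-at-all-scales (clustering-flavoured) — the comparability `u ≤ c·a` is exactly the fine side of «floor pins the
unit», an interface fact between the residual's unit map and Bałaban's.  Nothing here is proved about `MomentBounds6` itself.

Honest label: a CONDITIONAL transport lemma inside a conditional rung line (leaf R2a `BalabanLadder.NT`); no stub of 24275 is
closed by it; nothing here bears on the Yang–Mills mass gap, which is NOT proved by any of this.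
-/

set_option autoImplicit false

noncomputable section

namespace Summit.QuantumFields.YangMills.Cruxes.RunningCouplingCeiling.Pointwise

open MeasureTheory Filter Topology
open Literature.MathematicalPhysics.QuantumFieldTheory Literature.MathematicalPhysics.QuantumLattice
open Literature.Probability.LatticeModels
open Summit.QuantumFields.YangMills.Cruxes.OSLegsFromFemtoAndGap.DlrCollarTransfer
open Summit.QuantumFields.YangMills.Cruxes.UVSeamRec.CeilingsTransfer (momentBounds6_of_eventually_le)

variable {G : Type} [Group G] [TopologicalSpace G] [IsTopologicalGroup G] [CompactSpace G]
  [MeasurableSpace G] [BorelSpace G] (r : LatticeRep G)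

/-- **The local scale-free clause in the unit `a` from `MomentBounds6` in a reference unit `u` with `u ≤ c·a` eventually.**
If `MomentBounds6 G r u` holds and the unit map `a → 0⁺` is not finer than `u` up to the constant `c > 0`
(`∀ᶠ β, u β ≤ c · a β`), then for every `ℓ > 0` there are `C₁ n₀ β₀` with `d⁸ |torusCov β L x y| ≤ C₁` whenever `n₀ ≤ d` and
`a(β)·d ≤ ℓ` (`β ≥ β₀`, every odd torus, `d` the torus distance).  (`momentBounds6_of_eventually_le` then
`localScaleFree_of_momentBounds6`.) [folklore] -/
theorem localScaleFree_of_momentBounds6_of_eventually_le {a u : ℝ → ℝ} {c : ℝ} (hc : 0 < c)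
    (hle : ∀ᶠ β in atTop, u β ≤ c * a β) (hu : MomentBounds6 G r u)
    (ha : ∀ β, 0 < a β) (ha0 : Tendsto a atTop (𝓝 0)) (ℓ : ℝ) (hℓ : 0 < ℓ) :
    ∃ C₁ : ℝ, ∃ n₀ : ℕ, ∃ β₀ : ℝ, ∀ β : ℝ, β₀ ≤ β → ∀ (L : ℕ) (x y : Fin 4 → ℤ),
      (n₀ : ℝ) ≤ torusDist L x y → a β * torusDist L x y ≤ ℓ →
        torusDist L x y ^ 8 * |torusCov G r β L x y| ≤ C₁ :=
  localScaleFree_of_momentBounds6 r ha ha0 (momentBounds6_of_eventually_le r hc hle hu) ℓ hℓ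

end Summit.QuantumFields.YangMills.Cruxes.RunningCouplingCeiling.Pointwise

end
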